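import Literature.RingTheory.MvPolynomial.CubicFormLinearSubspaces
import Literature.RingTheory.MvPolynomial.VanishingOnSubspace
import Literature.RingTheory.MvPolynomial.Directrix
import Mathlib.LinearAlgebra.Matrix.Rank
import Mathlib.LinearAlgebra.FiniteDimensional.Lemmas
import HarnessLib

/-!
# Chains of isotropic subspaces of a cubic form (planes of a cubic hypersurface joined by 3-planes)

Let `F` be a cubic form on `V = kᴺ⁺¹`, `k` algebraically closed. A subspace `W ⊆ V` is
*isotropic* if `F` vanishes at every vector of `W` (so `ℙ(W)` is a linear subspace of the cubic
hypersurface `V₊(F) ⊆ ℙᴺ`). This file proves the linear-algebra existence statements behind the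
elementary chain argument "any two planes of a cubic hypersurface of large dimension are joined by
a chain of planes, consecutive ones spanning a `3`-plane of the hypersurface":

* `eval_eval_smul_eq_of_isBihom_of_vanishing` — the verification step of the greedy construction
  (`Literature/RingTheory/MvPolynomial/CubicFormLinearSubspaces.lean`) when only the coefficients
  of the monomials NOT killed by the zero coordinates of the substitution are required to vanish;
* `exists_common_zero_two_subframes` — **the greedy step for TWO sub-frames of one frame**: for an
  independent frame `e₀, …, e_{m-1}` and two indices `i₁, i₂` such that `F` vanishes on the span of
  the `e_j`, `j ≠ i₂`, and on the span of the `e_j`, `j ≠ i₁`, a vector `y ∉ span(e)` with `F`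
  vanishing on both spans enlarged by `y`, as soon as
  `#{monomials s^α, |α| ≤ 2, α_{i₁} = 0 ∨ α_{i₂} = 0} + m < N + 1` (the coefficients shared by the
  two expansions are counted once: `14` for two `3`-spaces through a common `2`-space, `9` for two
  `2`-spaces through a common line, `5` for two lines: `card_filter_fin_four_or`,
  `card_filter_fin_three_or`, `card_filter_fin_two_or`);
* `exists_isotropic_succ`, `exists_isotropic_finrank_three_ge` — every isotropic subspace of
  dimension `≤ 2` lies in an isotropic subspace of dimension `3` (`N ≥ 8`);
* `exists_common_isotropic_extension` — for isotropic `W₁, W₂` of dimension `d + 1` meeting in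
  dimension `d` (`d = 1`: `N ≥ 12`; `d = 2`: `N ≥ 18`) a vector `y ∉ W₁ + W₂` with `W₁ + ky` and
  `W₂ + ky` isotropic
  (the case `d = 0`, `5 + 2 < N + 1`: two zeros `p, p'` of `F` are joined to a common `y` by
  isotropic `span(p, y)`, `span(p', y)`, cf.
  `Literature.RingTheory.MvPolynomial.exists_common_line_vector_of_cubic`);
* `exists_frame_of_linearIndependent_linearForms` — the common kernel of `t` independent linear
  forms has an independent frame of `N + 1 - t` vectors (rank–nullity);
* `exists_linearForms_forall_mem_ideal_span_vanishing` — the linear forms of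
  `Literature.RingTheory.MvPolynomial.exists_linearForms_forall_mem_ideal_span` (every polynomial
  vanishing on `span(w)` lies in their ideal) themselves vanish on `span(w)`.

Everything is proved; no definitions. [folklore]
-/

noncomputable section

open MvPolynomial

namespace Literature.RingTheory.MvPolynomial

universe u

variable {k : Type u} [Field k] {N : ℕ}

/-! ### The greedy step for two sub-frames of one frame -/

section TwoSubframes

variable {m : ℕ}

/-- **Verification step with killed monomials.** If `P ∈ (k[y])[s]` is bihomogeneous of degree
`3`, `c : Fin m → k` a substitution and `v` a common zero of the coefficients `coeff_α P`,
`|α| < 3`, of those monomials `s^α` not killed by `c` (`α_j = 0` whenever `c_j = 0`), then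
`P(s := c)(y := t v)` does not depend on `t`. [folklore] -/
theorem eval_eval_smul_eq_of_isBihom_of_vanishing
    {P : MvPolynomial (Fin m) (MvPolynomial (Fin (N + 1)) k)}
    (hP : ∀ α, (coeff α P).IsHomogeneous (3 - α.degree) ∧ (3 < α.degree → coeff α P = 0))
    (c : Fin m → k) {v : Fin (N + 1) → k}
    (hv : ∀ α ∈ P.support, α.degree < 3 → (∀ j, c j = 0 → α j = 0) → eval v (coeff α P) = 0)
    (t : k) :
    eval (t • v) (eval (fun j => C (c j)) P) =
      eval (0 : Fin (N + 1) → k) (eval (fun j => C (c j)) P) := by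
  rw [eval_eval_eq_sum, eval_eval_eq_sum]
  refine Finset.sum_congr rfl fun α hα => ?_
  by_cases hkill : ∀ j, c j = 0 → α j = 0
  · congr 1
    rw [eval_smul_of_isHomogeneous (hP α).1,
      show (0 : Fin (N + 1) → k) = (0 : k) • v from (zero_smul k v).symm,
      eval_smul_of_isHomogeneous (hP α).1]
    by_cases hdeg : α.degree < 3
    · rw [hv α hα hdeg hkill, mul_zero, mul_zero]
    · have h3 : 3 - α.degree = 0 := by omega
      rw [h3, pow_zero, pow_zero]
  · push Not at hkill
    obtain ⟨j, hcj, hαj⟩ := hkill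
    have h0 : (∏ i, c i ^ α i) = 0 :=
      Finset.prod_eq_zero (Finset.mem_univ j) (by rw [hcj, zero_pow hαj])
    rw [h0, zero_mul, zero_mul]

/-- Counting the conditions: the exponents `α` of degree `≤ 2` with `α_{i₁} = 0 ∨ α_{i₂} = 0`
inject into the maps `f : Fin m → Fin 3` with `Σ f ≤ 2` and `f i₁ = 0 ∨ f i₂ = 0`. [folklore] -/
theorem card_le_filter_of_degree_lt_three_or (i₁ i₂ : Fin m) (S : Finset (Fin m →₀ ℕ))
    (hS : ∀ α ∈ S, α.degree < 3 ∧ (α i₁ = 0 ∨ α i₂ = 0)) :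
    S.card ≤ (Finset.univ.filter (fun f : Fin m → Fin 3 =>
      ∑ j, (f j : ℕ) ≤ 2 ∧ (f i₁ = 0 ∨ f i₂ = 0))).card := by
  classical
  have hle : ∀ α ∈ S, ∀ j, α j ≤ 2 := fun α hα j =>
    Nat.le_of_lt_succ (lt_of_le_of_lt (Finsupp.le_degree j α) (hS α hα).1)
  refine Finset.card_le_card_of_injOn (fun α j => (⟨min (α j) 2, by omega⟩ : Fin 3))
    (fun α hα => ?_) (fun α hα β hβ h => ?_)
  · rw [Finset.coe_filter]
    refine ⟨Finset.mem_univ _, ?_, ?_⟩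
    · have h1 : ∑ j, (min (α j) 2 : ℕ) = ∑ j, α j :=
        Finset.sum_congr rfl fun j _ => min_eq_left (hle α hα j)
      rw [h1, ← Finsupp.degree_eq_sum]
      exact Nat.le_of_lt_succ (hS α hα).1
    · rcases (hS α hα).2 with h | h
      · left; exact Fin.ext (by simp [h])
      · right; exact Fin.ext (by simp [h])
  · ext j
    have hj := congr_fun h j
    simp only [Fin.mk.injEq] at hj
    rwa [min_eq_left (hle α hα j), min_eq_left (hle β hβ j)] at hj

/-- **The greedy step for two sub-frames of one frame.** Let `F` be a cubic form on `kᴺ⁺¹`, `k`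
algebraically closed, `e₀, …, e_{m-1}` linearly independent, and `i₁, i₂` two indices such that
`F` vanishes identically on `span(e_j : j ≠ i₂)` and on `span(e_j : j ≠ i₁)`. If
`#{f : Fin m → Fin 3, Σ f ≤ 2, f i₁ = 0 ∨ f i₂ = 0} + m < N + 1`, there is `y ∉ span(e)` such that
`F` vanishes identically on `span(y, e_j : j ≠ i₂)` and on `span(y, e_j : j ≠ i₁)`: in the
expansion `F(Σ_j s_j e_j + y) = Σ_α s^α P_α(y)` only the coefficients `P_α`, `|α| ≤ 2`, of the
monomials involving at most one of `s_{i₁}, s_{i₂}` need to vanish at `y` (the others are killed by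
the substitutions `s_{i₂} = 0`, resp. `s_{i₁} = 0`), and the coefficients of the monomials in the
common variables are shared by the two conditions. [folklore] -/
theorem exists_common_zero_two_subframes [IsAlgClosed k] {F : MvPolynomial (Fin (N + 1)) k}
    (hF : F.IsHomogeneous 3) {e : Fin m → Fin (N + 1) → k} (he : LinearIndependent k e)
    (i₁ i₂ : Fin m)
    (h₁ : ∀ c : Fin m → k, c i₂ = 0 → eval (fun x => ∑ j, c j * e j x) F = 0)
    (h₂ : ∀ c : Fin m → k, c i₁ = 0 → eval (fun x => ∑ j, c j * e j x) F = 0)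
    (hN : (Finset.univ.filter (fun f : Fin m → Fin 3 =>
      ∑ j, (f j : ℕ) ≤ 2 ∧ (f i₁ = 0 ∨ f i₂ = 0))).card + m < N + 1) :
    ∃ y : Fin (N + 1) → k, y ∉ Submodule.span k (Set.range e) ∧
      (∀ (c : Fin m → k) (t : k), c i₂ = 0 →
        eval (fun x => (∑ j, c j * e j x) + t * y x) F = 0) ∧
      (∀ (c : Fin m → k) (t : k), c i₁ = 0 →
        eval (fun x => (∑ j, c j * e j x) + t * y x) F = 0) := by
  classical
  -- the substituted form `P = F(Σ_j s_j e_j + y)` and its bihomogeneity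
  set P : MvPolynomial (Fin m) (MvPolynomial (Fin (N + 1)) k) :=
    aeval (fun x : Fin (N + 1) =>
      (∑ j : Fin m, C (C (e j x)) * X j) + C (X x) :
        Fin (N + 1) → MvPolynomial (Fin m) (MvPolynomial (Fin (N + 1)) k)) F with hP_def
  have hP : ∀ α, (coeff α P).IsHomogeneous (3 - α.degree) ∧ (3 < α.degree → coeff α P = 0) := by
    refine isBihom_aeval hF _ fun x => ?_
    refine isBihom_add (isBihom_sum _ _ fun j _ => ?_)
      (isBihom_C_of_isHomogeneous_one (isHomogeneous_X k x))
    simpa using isBihom_mul (isBihom_C_C (σ := Fin m) (τ := Fin (N + 1)) (e j x))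
      (isBihom_X (k := k) (τ := Fin (N + 1)) j)
  -- a retraction `ψ` of `c ↦ Σ_j c_j e_j`
  have hinj : Function.Injective (Fintype.linearCombination k e) :=
    linearIndependent_iff_injective_fintypeLinearCombination.mp he
  obtain ⟨ψ, hψ⟩ := LinearMap.exists_leftInverse_of_injective _ (LinearMap.ker_eq_bot.mpr hinj)
  -- the system of conditions
  set S : Finset (Fin m →₀ ℕ) :=
    P.support.filter (fun α => α.degree < 3 ∧ (α i₁ = 0 ∨ α i₂ = 0)) with hS_def
  have hSd : ∀ α ∈ S, α.degree < 3 ∧ (α i₁ = 0 ∨ α i₂ = 0) := fun α hα =>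
    (Finset.mem_filter.mp hα).2
  let g : ↥S ⊕ Fin m → MvPolynomial (Fin (N + 1)) k :=
    Sum.elim (fun α => coeff α.1 P) (fun j => ∑ x : Fin (N + 1), C (ψ (Pi.single x 1) j) * X x)
  let deg : ↥S ⊕ Fin m → ℕ := Sum.elim (fun α => 3 - α.1.degree) (fun _ => 1)
  have hg : ∀ i, (g i).IsHomogeneous (deg i) := by
    rintro (α | j)
    · exact (hP α.1).1
    · exact isHomogeneous_escapeForm ψ j
  have hdeg : ∀ i, 0 < deg i := by
    rintro (α | j)
    · have := (hSd α.1 α.2).1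
      change 0 < 3 - α.1.degree
      omega
    · exact Nat.one_pos
  have hcard : Fintype.card (↥S ⊕ Fin m) < N + 1 := by
    rw [Fintype.card_sum, Fintype.card_fin, Fintype.card_coe]
    exact lt_of_le_of_lt
      (Nat.add_le_add_right (card_le_filter_of_degree_lt_three_or i₁ i₂ S hSd) m) hN
  obtain ⟨y, hy0, hy⟩ :=
    Literature.RingTheory.KrullDimension.exists_ne_zero_common_zero_of_isHomogeneous g deg hg hdeg
      hcard
  have hyS : ∀ α ∈ P.support, α.degree < 3 → (α i₁ = 0 ∨ α i₂ = 0) →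
      eval y (coeff α P) = 0 :=
    fun α hα hlt hor => hy (Sum.inl ⟨α, Finset.mem_filter.mpr ⟨hα, hlt, hor⟩⟩)
  have hyψ : ψ y = 0 := by
    ext j
    rw [← eval_escapeForm ψ j y]
    exact hy (Sum.inr j)
  have hy_span : y ∉ Submodule.span k (Set.range e) := by
    intro hmem
    rw [← Fintype.range_linearCombination] at hmem
    obtain ⟨c, rfl⟩ := hmem
    have hc : ψ (Fintype.linearCombination k e c) = c := by
      have := LinearMap.congr_fun hψ c
      simpa using this
    have hc0 : c = 0 := hc.symm.trans hyψ
    exact hy0 (by rw [hc0, map_zero])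
  -- verification, for a substitution killing `s_{i₂}` (resp. `s_{i₁}`)
  have key : ∀ (c : Fin m → k) (t : k), (∀ α ∈ P.support, α.degree < 3 →
      (∀ j, c j = 0 → α j = 0) → eval y (coeff α P) = 0) →
      eval (fun x => ∑ j, c j * e j x) F = 0 →
        eval (fun x => (∑ j, c j * e j x) + t * y x) F = 0 := by
    intro c t hc h0
    have hk := eval_eval_smul_eq_of_isBihom_of_vanishing hP c hc t
    rw [hP_def] at hk
    rw [eval_eval_aeval_lin, eval_eval_aeval_lin] at hk
    have h0' : eval (fun x => (∑ j, c j * e j x) + (0 : Fin (N + 1) → k) x) F = 0 := by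
      simpa using h0
    rw [h0'] at hk
    have hfun : (fun x => (∑ j, c j * e j x) + t * y x) =
        fun x => (∑ j, c j * e j x) + (t • y) x := by
      ext x
      simp only [Pi.smul_apply, smul_eq_mul]
    rw [hfun]
    exact hk
  refine ⟨y, hy_span, fun c t hc => key c t (fun α hα hlt hαc => ?_) (h₁ c hc),
    fun c t hc => key c t (fun α hα hlt hαc => ?_) (h₂ c hc)⟩
  · exact hyS α hα hlt (Or.inr (hαc i₂ hc))
  · exact hyS α hα hlt (Or.inl (hαc i₁ hc))

/-- **The greedy step for two sub-frames, escaping only part of the frame.** As in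
`exists_common_zero_two_subframes`, but the new vector `y` is only required to avoid the span of
the `e_j`, `j ∈ S`, for a set `S` of indices, at the cost of `#S` (instead of `m`) escape
conditions: `#{f : Fin m → Fin 3, Σ f ≤ 2, f i₁ = 0 ∨ f i₂ = 0} + #S < N + 1`. (For two `3`-spaces
through a common `2`-space `U` one escapes only `U`: `14 + 2 < N + 1`.) [folklore] -/
theorem exists_common_zero_two_subframes_escaping [IsAlgClosed k] {F : MvPolynomial (Fin (N + 1)) k}
    (hF : F.IsHomogeneous 3) {e : Fin m → Fin (N + 1) → k} (he : LinearIndependent k e)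
    (i₁ i₂ : Fin m) (S : Finset (Fin m))
    (h₁ : ∀ c : Fin m → k, c i₂ = 0 → eval (fun x => ∑ j, c j * e j x) F = 0)
    (h₂ : ∀ c : Fin m → k, c i₁ = 0 → eval (fun x => ∑ j, c j * e j x) F = 0)
    (hN : (Finset.univ.filter (fun f : Fin m → Fin 3 =>
      ∑ j, (f j : ℕ) ≤ 2 ∧ (f i₁ = 0 ∨ f i₂ = 0))).card + S.card < N + 1) :
    ∃ y : Fin (N + 1) → k, y ∉ Submodule.span k (e '' ↑S) ∧
      (∀ (c : Fin m → k) (t : k), c i₂ = 0 →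
        eval (fun x => (∑ j, c j * e j x) + t * y x) F = 0) ∧
      (∀ (c : Fin m → k) (t : k), c i₁ = 0 →
        eval (fun x => (∑ j, c j * e j x) + t * y x) F = 0) := by
  classical
  -- the substituted form `P = F(Σ_j s_j e_j + y)` and its bihomogeneity
  set P : MvPolynomial (Fin m) (MvPolynomial (Fin (N + 1)) k) :=
    aeval (fun x : Fin (N + 1) =>
      (∑ j : Fin m, C (C (e j x)) * X j) + C (X x) :
        Fin (N + 1) → MvPolynomial (Fin m) (MvPolynomial (Fin (N + 1)) k)) F with hP_def
  have hP : ∀ α, (coeff α P).IsHomogeneous (3 - α.degree) ∧ (3 < α.degree → coeff α P = 0) := by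
    refine isBihom_aeval hF _ fun x => ?_
    refine isBihom_add (isBihom_sum _ _ fun j _ => ?_)
      (isBihom_C_of_isHomogeneous_one (isHomogeneous_X k x))
    simpa using isBihom_mul (isBihom_C_C (σ := Fin m) (τ := Fin (N + 1)) (e j x))
      (isBihom_X (k := k) (τ := Fin (N + 1)) j)
  -- the sub-frame `u = e|_S` (reindexed by `Fin #S`) and a retraction `ψ` of `c ↦ Σ_a c_a u_a`
  set u : Fin S.card → Fin (N + 1) → k := fun a => e (S.equivFin.symm a) with hu_def
  have hu : LinearIndependent k u :=
    he.comp _ (Subtype.val_injective.comp S.equivFin.symm.injective)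
  have hurange : Set.range u = e '' ↑S := by
    ext v
    constructor
    · rintro ⟨a, rfl⟩
      exact ⟨_, (S.equivFin.symm a).2, rfl⟩
    · rintro ⟨j, hj, rfl⟩
      exact ⟨S.equivFin ⟨j, hj⟩, by simp [hu_def]⟩
  have hinj : Function.Injective (Fintype.linearCombination k u) :=
    linearIndependent_iff_injective_fintypeLinearCombination.mp hu
  obtain ⟨ψ, hψ⟩ := LinearMap.exists_leftInverse_of_injective _ (LinearMap.ker_eq_bot.mpr hinj)
  -- the system of conditions: coefficients, and escape forms for the sub-frame only
  set T : Finset (Fin m →₀ ℕ) :=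
    P.support.filter (fun α => α.degree < 3 ∧ (α i₁ = 0 ∨ α i₂ = 0)) with hT_def
  have hTd : ∀ α ∈ T, α.degree < 3 ∧ (α i₁ = 0 ∨ α i₂ = 0) := fun α hα =>
    (Finset.mem_filter.mp hα).2
  let g : ↥T ⊕ Fin S.card → MvPolynomial (Fin (N + 1)) k :=
    Sum.elim (fun α => coeff α.1 P) (fun a => ∑ x : Fin (N + 1), C (ψ (Pi.single x 1) a) * X x)
  let deg : ↥T ⊕ Fin S.card → ℕ := Sum.elim (fun α => 3 - α.1.degree) (fun _ => 1)
  have hg : ∀ i, (g i).IsHomogeneous (deg i) := by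
    rintro (α | a)
    · exact (hP α.1).1
    · exact isHomogeneous_escapeForm ψ a
  have hdeg : ∀ i, 0 < deg i := by
    rintro (α | a)
    · have := (hTd α.1 α.2).1
      change 0 < 3 - α.1.degree
      omega
    · exact Nat.one_pos
  have hcard : Fintype.card (↥T ⊕ Fin S.card) < N + 1 := by
    rw [Fintype.card_sum, Fintype.card_coe, Fintype.card_fin]
    exact lt_of_le_of_lt
      (Nat.add_le_add_right (card_le_filter_of_degree_lt_three_or i₁ i₂ T hTd) S.card) hN
  obtain ⟨y, hy0, hy⟩ :=
    Literature.RingTheory.KrullDimension.exists_ne_zero_common_zero_of_isHomogeneous g deg hg hdeg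
      hcard
  have hyT : ∀ α ∈ P.support, α.degree < 3 → (α i₁ = 0 ∨ α i₂ = 0) →
      eval y (coeff α P) = 0 :=
    fun α hα hlt hor => hy (Sum.inl ⟨α, Finset.mem_filter.mpr ⟨hα, hlt, hor⟩⟩)
  have hyψ : ψ y = 0 := by
    ext a
    rw [← eval_escapeForm ψ a y]
    exact hy (Sum.inr a)
  have hy_span : y ∉ Submodule.span k (e '' ↑S) := by
    rw [← hurange]
    intro hmem
    rw [← Fintype.range_linearCombination] at hmem
    obtain ⟨c, rfl⟩ := hmem
    have hc : ψ (Fintype.linearCombination k u c) = c := by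
      have := LinearMap.congr_fun hψ c
      simpa using this
    have hc0 : c = 0 := hc.symm.trans hyψ
    exact hy0 (by rw [hc0, map_zero])
  -- verification, for a substitution killing `s_{i₂}` (resp. `s_{i₁}`)
  have key : ∀ (c : Fin m → k) (t : k), (∀ α ∈ P.support, α.degree < 3 →
      (∀ j, c j = 0 → α j = 0) → eval y (coeff α P) = 0) →
      eval (fun x => ∑ j, c j * e j x) F = 0 →
        eval (fun x => (∑ j, c j * e j x) + t * y x) F = 0 := by
    intro c t hc h0
    have hk := eval_eval_smul_eq_of_isBihom_of_vanishing hP c hc t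
    rw [hP_def] at hk
    rw [eval_eval_aeval_lin, eval_eval_aeval_lin] at hk
    have h0' : eval (fun x => (∑ j, c j * e j x) + (0 : Fin (N + 1) → k) x) F = 0 := by
      simpa using h0
    rw [h0'] at hk
    have hfun : (fun x => (∑ j, c j * e j x) + t * y x) =
        fun x => (∑ j, c j * e j x) + (t • y) x := by
      ext x
      simp only [Pi.smul_apply, smul_eq_mul]
    rw [hfun]
    exact hk
  refine ⟨y, hy_span, fun c t hc => key c t (fun α hα hlt hαc => ?_) (h₁ c hc),
    fun c t hc => key c t (fun α hα hlt hαc => ?_) (h₂ c hc)⟩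
  · exact hyT α hα hlt (Or.inr (hαc i₂ hc))
  · exact hyT α hα hlt (Or.inl (hαc i₁ hc))

/-- The count for two `3`-spaces through a common `2`-space (frame of `4` vectors, the two extra
vectors at the indices `0, 1`): `14` monomials of degree `≤ 2` in `s₀, …, s₃` avoid `s₀ s₁`.
[folklore] -/
theorem card_filter_fin_four_or :
    (Finset.univ.filter (fun f : Fin 4 → Fin 3 =>
      ∑ j, (f j : ℕ) ≤ 2 ∧ (f 1 = 0 ∨ f 0 = 0))).card = 14 := by
  decide

/-- The count for two `2`-spaces through a common line (frame of `3` vectors, the two extra vectors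
at the indices `0, 1`): `9` monomials of degree `≤ 2` in `s₀, s₁, s₂` avoid `s₀ s₁`. [folklore] -/
theorem card_filter_fin_three_or :
    (Finset.univ.filter (fun f : Fin 3 → Fin 3 =>
      ∑ j, (f j : ℕ) ≤ 2 ∧ (f 1 = 0 ∨ f 0 = 0))).card = 9 := by
  decide

/-- The count for two lines through the origin (frame of `2` vectors): `5` monomials of degree
`≤ 2` in `s₀, s₁` avoid `s₀ s₁`. [folklore] -/
theorem card_filter_fin_two_or :
    (Finset.univ.filter (fun f : Fin 2 → Fin 3 =>
      ∑ j, (f j : ℕ) ≤ 2 ∧ (f 1 = 0 ∨ f 0 = 0))).card = 5 := by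
  decide

end TwoSubframes

/-! ### Isotropic subspaces: extensions and common extensions -/

section Isotropic

variable {F : MvPolynomial (Fin (N + 1)) k}

/-- Pointwise vanishing on all `Σ_j c_j w_j` is vanishing on `span(w)`. [folklore] -/
theorem forall_mem_span_range_eval_eq_zero {u : ℕ} {w : Fin u → Fin (N + 1) → k}
    (hv : ∀ c : Fin u → k, eval (fun m => ∑ j, c j * w j m) F = 0) :
    ∀ v ∈ Submodule.span k (Set.range w), eval v F = 0 := by
  intro v hv'
  rw [← Fintype.range_linearCombination] at hv'
  obtain ⟨c, rfl⟩ := hv'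
  have h : (Fintype.linearCombination k w c : Fin (N + 1) → k) = fun m => ∑ j, c j * w j m := by
    ext m
    simp [Fintype.linearCombination_apply, Finset.sum_apply]
  rw [h]
  exact hv c

/-- The combination `x ↦ Σ_j c_j e_j(x)` is the vector `Σ_j c_j • e_j`. [folklore] -/
theorem sum_mul_apply_eq_sum_smul {m : ℕ} (e : Fin m → Fin (N + 1) → k) (c : Fin m → k) :
    (fun x => ∑ j, c j * e j x) = ∑ j, c j • e j := by
  funext x
  simp [Finset.sum_apply, Pi.smul_apply]

/-- An independent frame of a finite-dimensional subspace: `finrank W` linearly independent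
vectors of `kᴺ⁺¹` spanning `W`. [folklore] -/
theorem exists_frame_of_finrank_eq {W : Submodule k (Fin (N + 1) → k)} {d : ℕ}
    (hW : Module.finrank k W = d) :
    ∃ w : Fin d → Fin (N + 1) → k, LinearIndependent k w ∧ Submodule.span k (Set.range w) = W := by
  let b := Module.finBasisOfFinrankEq k W hW
  refine ⟨fun j => (b j : Fin (N + 1) → k), ?_, ?_⟩
  · exact b.linearIndependent.map' W.subtype (Submodule.ker_subtype W)
  · have h : Set.range (fun j => (b j : Fin (N + 1) → k)) = W.subtype '' Set.range b := by
      ext x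
      simp
    rw [h, Submodule.span_image, b.span_eq, Submodule.map_top, Submodule.range_subtype]

/-- **One greedy step, subspace form**: an isotropic subspace of dimension `d ≤ 2` of a cubic form
in `N + 1 ≥ 9` variables lies in an isotropic subspace of dimension `d + 1`. [folklore] -/
theorem exists_isotropic_succ [IsAlgClosed k] (hN : 8 ≤ N) (hF : F.IsHomogeneous 3)
    {W : Submodule k (Fin (N + 1) → k)} {d : ℕ} (hd : d ≤ 2) (hW : Module.finrank k W = d)
    (hiso : ∀ v ∈ W, eval v F = 0) :
    ∃ W' : Submodule k (Fin (N + 1) → k), W ≤ W' ∧ Module.finrank k W' = d + 1 ∧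
      ∀ v ∈ W', eval v F = 0 := by
  have hcount : (Finset.univ.filter (fun f : Fin d → Fin 3 => ∑ j, (f j : ℕ) ≤ 2)).card + d <
      N + 1 := by
    interval_cases d
    · rw [card_filter_fin_zero]; omega
    · rw [card_filter_fin_one]; omega
    · rw [card_filter_fin_two]; omega
  obtain ⟨w, hw, hspan⟩ := exists_frame_of_finrank_eq hW
  have hvan : ∀ c : Fin d → k, eval (fun m => ∑ j, c j * w j m) F = 0 := by
    intro c
    rw [sum_mul_apply_eq_sum_smul]
    refine hiso _ (Submodule.sum_mem _ fun j _ => Submodule.smul_mem _ _ ?_)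
    rw [← hspan]
    exact Submodule.subset_span ⟨j, rfl⟩
  obtain ⟨y, hy, hvy⟩ := exists_finCons_eval_eq_zero hF hw hvan hcount
  refine ⟨Submodule.span k (Set.range (Fin.cons y w : Fin (d + 1) → Fin (N + 1) → k)), ?_, ?_,
    forall_mem_span_range_eval_eq_zero hvy⟩
  · rw [← hspan]
    refine Submodule.span_mono ?_
    rw [Fin.range_cons]
    exact Set.subset_insert _ _
  · rw [finrank_span_eq_card hy, Fintype.card_fin]

/-- **Every isotropic subspace of dimension `≤ 2` lies in an isotropic subspace of dimension `3`**
(cubic form in `N + 1 ≥ 9` variables, `k` algebraically closed): e.g. every point of a cubic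
hypersurface of dimension `≥ 7` lies on a plane of it, and every line of it lies in a plane of it.
[folklore] -/
theorem exists_isotropic_finrank_three_ge [IsAlgClosed k] (hN : 8 ≤ N) (hF : F.IsHomogeneous 3)
    {W : Submodule k (Fin (N + 1) → k)} (hd : Module.finrank k W ≤ 2)
    (hiso : ∀ v ∈ W, eval v F = 0) :
    ∃ Q : Submodule k (Fin (N + 1) → k), W ≤ Q ∧ Module.finrank k Q = 3 ∧ ∀ v ∈ Q, eval v F = 0 := by
  obtain ⟨d, hW⟩ : ∃ d, Module.finrank k W = d := ⟨_, rfl⟩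
  rw [hW] at hd
  interval_cases d
  · obtain ⟨W₁, h01, h1, hiso₁⟩ := exists_isotropic_succ hN hF (d := 0) (by omega) hW hiso
    obtain ⟨W₂, h12, h2, hiso₂⟩ := exists_isotropic_succ hN hF (d := 1) (by omega) h1 hiso₁
    obtain ⟨W₃, h23, h3, hiso₃⟩ := exists_isotropic_succ hN hF (d := 2) (by omega) h2 hiso₂
    exact ⟨W₃, h01.trans (h12.trans h23), h3, hiso₃⟩
  · obtain ⟨W₂, h12, h2, hiso₂⟩ := exists_isotropic_succ hN hF (d := 1) (by omega) hW hiso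
    obtain ⟨W₃, h23, h3, hiso₃⟩ := exists_isotropic_succ hN hF (d := 2) (by omega) h2 hiso₂
    exact ⟨W₃, h12.trans h23, h3, hiso₃⟩
  · obtain ⟨W₃, h23, h3, hiso₃⟩ := exists_isotropic_succ hN hF (d := 2) (by omega) hW hiso
    exact ⟨W₃, h23, h3, hiso₃⟩

/-- **Common isotropic extension of two isotropic subspaces meeting in codimension one.** Let `F`
be a cubic form on `kᴺ⁺¹`, `k` algebraically closed, and `W₁, W₂` isotropic subspaces of dimension
`d + 1` with `dim (W₁ ∩ W₂) = d`. If `#{f : Fin (d+2) → Fin 3, Σ f ≤ 2, f 1 = 0 ∨ f 0 = 0} + (d + 2)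
< N + 1` (`d = 1`: `9 + 3 < N + 1`; `d = 2`: `14 + 4 < N + 1`), there is a vector `y ∉ W₁ + W₂`
such that `W₁ + ky` and `W₂ + ky` are isotropic (`exists_common_zero_two_subframes` for the frame
`(v₂, v₁, u)`, `u` a frame of `W₁ ∩ W₂`, `W_a = span(v_a, u)`). [folklore] -/
theorem exists_common_isotropic_extension [IsAlgClosed k] (hF : F.IsHomogeneous 3) {d : ℕ}
    {W₁ W₂ : Submodule k (Fin (N + 1) → k)} (h₁ : Module.finrank k W₁ = d + 1)
    (h₂ : Module.finrank k W₂ = d + 1) (h₁₂ : Module.finrank k ↥(W₁ ⊓ W₂) = d)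
    (hiso₁ : ∀ v ∈ W₁, eval v F = 0) (hiso₂ : ∀ v ∈ W₂, eval v F = 0)
    (hN : (Finset.univ.filter (fun f : Fin (d + 2) → Fin 3 =>
      ∑ j, (f j : ℕ) ≤ 2 ∧ (f 1 = 0 ∨ f 0 = 0))).card + (d + 2) < N + 1) :
    ∃ y : Fin (N + 1) → k, y ∉ W₁ ⊔ W₂ ∧ (∀ w ∈ W₁, ∀ t : k, eval (w + t • y) F = 0) ∧
      ∀ w ∈ W₂, ∀ t : k, eval (w + t • y) F = 0 := by
  classical
  -- a frame `u` of `U = W₁ ∩ W₂` and vectors `v₁ ∈ W₁ ∖ U`, `v₂ ∈ W₂ ∖ U`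
  obtain ⟨u, hu, hU⟩ := exists_frame_of_finrank_eq h₁₂
  have hlt₁ : W₁ ⊓ W₂ < W₁ := by
    refine lt_of_le_of_ne inf_le_left fun h => ?_
    have : Module.finrank k ↥(W₁ ⊓ W₂) = Module.finrank k ↥W₁ := by rw [h]
    omega
  have hlt₂ : W₁ ⊓ W₂ < W₂ := by
    refine lt_of_le_of_ne inf_le_right fun h => ?_
    have : Module.finrank k ↥(W₁ ⊓ W₂) = Module.finrank k ↥W₂ := by rw [h]
    omega
  obtain ⟨v₁, hv₁W, hv₁U⟩ := SetLike.exists_of_lt hlt₁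
  obtain ⟨v₂, hv₂W, hv₂U⟩ := SetLike.exists_of_lt hlt₂
  -- the frames `(v₁, u)` of `W₁` and `e = (v₂, v₁, u)` of `W₁ + W₂`
  have hind₁ : LinearIndependent k (Fin.cons v₁ u : Fin (d + 1) → Fin (N + 1) → k) :=
    hu.finCons (by rwa [hU])
  have hspan₁ : Submodule.span k (Set.range (Fin.cons v₁ u : Fin (d + 1) → Fin (N + 1) → k)) =
      W₁ := by
    apply Submodule.eq_of_le_of_finrank_eq
    · rw [Fin.range_cons, Submodule.span_insert, hU]
      exact sup_le ((Submodule.span_singleton_le_iff_mem _ _).2 hv₁W) inf_le_left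
    · rw [finrank_span_eq_card hind₁, Fintype.card_fin, h₁]
  have hv₂W₁ : v₂ ∉ W₁ := fun h => hv₂U ⟨h, hv₂W⟩
  set e : Fin (d + 2) → Fin (N + 1) → k := Fin.cons v₂ (Fin.cons v₁ u) with he_def
  have he : LinearIndependent k e := hind₁.finCons (by rwa [hspan₁])
  have he0 : e 0 = v₂ := rfl
  have he1 : e 1 = v₁ := rfl
  have hess : ∀ j : Fin d, e j.succ.succ = u j := fun j => rfl
  have huW : ∀ j : Fin d, u j ∈ W₁ ⊓ W₂ := fun j => by
    rw [← hU]; exact Submodule.subset_span ⟨j, rfl⟩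
  -- the two sub-frames span `W₁` (index `0` killed) and `W₂` (index `1` killed)
  have hmem₁ : ∀ c : Fin (d + 2) → k, c 0 = 0 → (∑ j, c j • e j) ∈ W₁ := by
    intro c hc
    refine Submodule.sum_mem _ fun j _ => ?_
    refine Fin.cases ?_ (fun j' => Fin.cases ?_ (fun j'' => ?_) j') j
    · rw [hc, zero_smul]; exact Submodule.zero_mem _
    · exact Submodule.smul_mem _ _ (by rw [show e (Fin.succ 0) = v₁ from rfl]; exact hv₁W)
    · exact Submodule.smul_mem _ _ (by rw [hess]; exact (huW j'').1)
  have hmem₂ : ∀ c : Fin (d + 2) → k, c 1 = 0 → (∑ j, c j • e j) ∈ W₂ := by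
    intro c hc
    refine Submodule.sum_mem _ fun j _ => ?_
    refine Fin.cases ?_ (fun j' => Fin.cases ?_ (fun j'' => ?_) j') j
    · exact Submodule.smul_mem _ _ (by rw [he0]; exact hv₂W)
    · rw [show c (Fin.succ 0) = 0 from hc, zero_smul]; exact Submodule.zero_mem _
    · exact Submodule.smul_mem _ _ (by rw [hess]; exact (huW j'').2)
  have hvan₁ : ∀ c : Fin (d + 2) → k, c 0 = 0 → eval (fun x => ∑ j, c j * e j x) F = 0 := by
    intro c hc
    rw [sum_mul_apply_eq_sum_smul]
    exact hiso₁ _ (hmem₁ c hc)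
  have hvan₂ : ∀ c : Fin (d + 2) → k, c 1 = 0 → eval (fun x => ∑ j, c j * e j x) F = 0 := by
    intro c hc
    rw [sum_mul_apply_eq_sum_smul]
    exact hiso₂ _ (hmem₂ c hc)
  obtain ⟨y, hy, hy₁, hy₂⟩ := exists_common_zero_two_subframes hF he 1 0 hvan₁ hvan₂ hN
  -- the frame `(v₂, u)` of `W₂`
  have hind₂ : LinearIndependent k (Fin.cons v₂ u : Fin (d + 1) → Fin (N + 1) → k) :=
    hu.finCons (by rwa [hU])
  have hspan₂ : Submodule.span k (Set.range (Fin.cons v₂ u : Fin (d + 1) → Fin (N + 1) → k)) =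
      W₂ := by
    apply Submodule.eq_of_le_of_finrank_eq
    · rw [Fin.range_cons, Submodule.span_insert, hU]
      exact sup_le ((Submodule.span_singleton_le_iff_mem _ _).2 hv₂W) inf_le_right
    · rw [finrank_span_eq_card hind₂, Fintype.card_fin, h₂]
  -- translating back to `W₁`, `W₂`
  have hrange : Set.range e = insert v₂ (insert v₁ (Set.range u)) := by
    rw [he_def, Fin.range_cons, Fin.range_cons]
  have hsup : W₁ ⊔ W₂ ≤ Submodule.span k (Set.range e) := by
    rw [hrange]
    refine sup_le ?_ ?_
    · rw [← hspan₁, Fin.range_cons]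
      exact Submodule.span_mono (Set.subset_insert _ _)
    · rw [← hspan₂, Fin.range_cons]
      exact Submodule.span_mono (Set.insert_subset_insert (Set.subset_insert _ _))
  have hfun : ∀ (c : Fin (d + 2) → k) (t : k),
      (fun x => (∑ j, c j * e j x) + t * y x) = (∑ j, c j • e j) + t • y := by
    intro c t
    funext x
    simp [Finset.sum_apply, Pi.smul_apply]
  refine ⟨y, fun h => hy (hsup h), fun w hw t => ?_, fun w hw t => ?_⟩
  · rw [← hspan₁, Submodule.mem_span_range_iff_exists_fun] at hw
    obtain ⟨c', rfl⟩ := hw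
    have h := hy₁ (Fin.cons 0 c') t rfl
    have hvec : (∑ j, (Fin.cons 0 c' : Fin (d + 2) → k) j • e j) =
        ∑ j, c' j • (Fin.cons v₁ u : Fin (d + 1) → Fin (N + 1) → k) j := by
      simp only [he_def, Fin.sum_univ_succ, Fin.cons_zero, Fin.cons_succ, zero_smul, zero_add]
    rw [hfun, hvec] at h
    exact h
  · rw [← hspan₂, Submodule.mem_span_range_iff_exists_fun] at hw
    obtain ⟨c', rfl⟩ := hw
    have h := hy₂ (Fin.cons (c' 0) (Fin.cons 0 (Fin.tail c'))) t rfl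
    have hvec : (∑ j, (Fin.cons (c' 0) (Fin.cons 0 (Fin.tail c')) : Fin (d + 2) → k) j • e j) =
        ∑ j, c' j • (Fin.cons v₂ u : Fin (d + 1) → Fin (N + 1) → k) j := by
      simp only [he_def, Fin.sum_univ_succ, Fin.cons_zero, Fin.cons_succ, Fin.tail, zero_smul,
        zero_add]
    rw [hfun, hvec] at h
    exact h

/-- **Common isotropic extension, escaping only the intersection.** As
`exists_common_isotropic_extension`, but `y` is only required to avoid `W₁ ∩ W₂`, with the count
`#{f : Fin (d+2) → Fin 3, Σ f ≤ 2, f 1 = 0 ∨ f 0 = 0} + d < N + 1` (`d = 2`: `14 + 2 < N + 1`); then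
`(W₁ ∩ W₂) + ky` has dimension `d + 1` and lies in the isotropic `W₁ + ky` and `W₂ + ky` (of
dimension `d + 1` or `d + 2`).

**Common isotropic extension of two isotropic subspaces meeting in codimension one.** Let `F`
be a cubic form on `kᴺ⁺¹`, `k` algebraically closed, and `W₁, W₂` isotropic subspaces of dimension
`d + 1` with `dim (W₁ ∩ W₂) = d`. If `#{f : Fin (d+2) → Fin 3, Σ f ≤ 2, f 1 = 0 ∨ f 0 = 0} + (d + 2)
< N + 1` (`d = 1`: `9 + 3 < N + 1`; `d = 2`: `14 + 4 < N + 1`), there is a vector `y ∉ W₁ + W₂`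
such that `W₁ + ky` and `W₂ + ky` are isotropic (`exists_common_zero_two_subframes` for the frame
`(v₂, v₁, u)`, `u` a frame of `W₁ ∩ W₂`, `W_a = span(v_a, u)`). [folklore] -/
theorem exists_common_isotropic_extension_inf [IsAlgClosed k] (hF : F.IsHomogeneous 3) {d : ℕ}
    {W₁ W₂ : Submodule k (Fin (N + 1) → k)} (h₁ : Module.finrank k W₁ = d + 1)
    (h₂ : Module.finrank k W₂ = d + 1) (h₁₂ : Module.finrank k ↥(W₁ ⊓ W₂) = d)
    (hiso₁ : ∀ v ∈ W₁, eval v F = 0) (hiso₂ : ∀ v ∈ W₂, eval v F = 0)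
    (hN : (Finset.univ.filter (fun f : Fin (d + 2) → Fin 3 =>
      ∑ j, (f j : ℕ) ≤ 2 ∧ (f 1 = 0 ∨ f 0 = 0))).card + d < N + 1) :
    ∃ y : Fin (N + 1) → k, y ∉ W₁ ⊓ W₂ ∧ (∀ w ∈ W₁, ∀ t : k, eval (w + t • y) F = 0) ∧
      ∀ w ∈ W₂, ∀ t : k, eval (w + t • y) F = 0 := by
  classical
  -- a frame `u` of `U = W₁ ∩ W₂` and vectors `v₁ ∈ W₁ ∖ U`, `v₂ ∈ W₂ ∖ U`
  obtain ⟨u, hu, hU⟩ := exists_frame_of_finrank_eq h₁₂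
  have hlt₁ : W₁ ⊓ W₂ < W₁ := by
    refine lt_of_le_of_ne inf_le_left fun h => ?_
    have : Module.finrank k ↥(W₁ ⊓ W₂) = Module.finrank k ↥W₁ := by rw [h]
    omega
  have hlt₂ : W₁ ⊓ W₂ < W₂ := by
    refine lt_of_le_of_ne inf_le_right fun h => ?_
    have : Module.finrank k ↥(W₁ ⊓ W₂) = Module.finrank k ↥W₂ := by rw [h]
    omega
  obtain ⟨v₁, hv₁W, hv₁U⟩ := SetLike.exists_of_lt hlt₁
  obtain ⟨v₂, hv₂W, hv₂U⟩ := SetLike.exists_of_lt hlt₂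
  -- the frames `(v₁, u)` of `W₁` and `e = (v₂, v₁, u)` of `W₁ + W₂`
  have hind₁ : LinearIndependent k (Fin.cons v₁ u : Fin (d + 1) → Fin (N + 1) → k) :=
    hu.finCons (by rwa [hU])
  have hspan₁ : Submodule.span k (Set.range (Fin.cons v₁ u : Fin (d + 1) → Fin (N + 1) → k)) =
      W₁ := by
    apply Submodule.eq_of_le_of_finrank_eq
    · rw [Fin.range_cons, Submodule.span_insert, hU]
      exact sup_le ((Submodule.span_singleton_le_iff_mem _ _).2 hv₁W) inf_le_left
    · rw [finrank_span_eq_card hind₁, Fintype.card_fin, h₁]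
  have hv₂W₁ : v₂ ∉ W₁ := fun h => hv₂U ⟨h, hv₂W⟩
  set e : Fin (d + 2) → Fin (N + 1) → k := Fin.cons v₂ (Fin.cons v₁ u) with he_def
  have he : LinearIndependent k e := hind₁.finCons (by rwa [hspan₁])
  have he0 : e 0 = v₂ := rfl
  have he1 : e 1 = v₁ := rfl
  have hess : ∀ j : Fin d, e j.succ.succ = u j := fun j => rfl
  have huW : ∀ j : Fin d, u j ∈ W₁ ⊓ W₂ := fun j => by
    rw [← hU]; exact Submodule.subset_span ⟨j, rfl⟩
  -- the two sub-frames span `W₁` (index `0` killed) and `W₂` (index `1` killed)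
  have hmem₁ : ∀ c : Fin (d + 2) → k, c 0 = 0 → (∑ j, c j • e j) ∈ W₁ := by
    intro c hc
    refine Submodule.sum_mem _ fun j _ => ?_
    refine Fin.cases ?_ (fun j' => Fin.cases ?_ (fun j'' => ?_) j') j
    · rw [hc, zero_smul]; exact Submodule.zero_mem _
    · exact Submodule.smul_mem _ _ (by rw [show e (Fin.succ 0) = v₁ from rfl]; exact hv₁W)
    · exact Submodule.smul_mem _ _ (by rw [hess]; exact (huW j'').1)
  have hmem₂ : ∀ c : Fin (d + 2) → k, c 1 = 0 → (∑ j, c j • e j) ∈ W₂ := by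
    intro c hc
    refine Submodule.sum_mem _ fun j _ => ?_
    refine Fin.cases ?_ (fun j' => Fin.cases ?_ (fun j'' => ?_) j') j
    · exact Submodule.smul_mem _ _ (by rw [he0]; exact hv₂W)
    · rw [show c (Fin.succ 0) = 0 from hc, zero_smul]; exact Submodule.zero_mem _
    · exact Submodule.smul_mem _ _ (by rw [hess]; exact (huW j'').2)
  have hvan₁ : ∀ c : Fin (d + 2) → k, c 0 = 0 → eval (fun x => ∑ j, c j * e j x) F = 0 := by
    intro c hc
    rw [sum_mul_apply_eq_sum_smul]
    exact hiso₁ _ (hmem₁ c hc)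
  have hvan₂ : ∀ c : Fin (d + 2) → k, c 1 = 0 → eval (fun x => ∑ j, c j * e j x) F = 0 := by
    intro c hc
    rw [sum_mul_apply_eq_sum_smul]
    exact hiso₂ _ (hmem₂ c hc)
  -- the indices `≥ 2` of the frame, spanning `U`
  set S : Finset (Fin (d + 2)) := Finset.univ.image (fun j : Fin d => j.succ.succ) with hS_def
  have hScard : S.card = d := by
    rw [hS_def, Finset.card_image_of_injective _ (fun a b h =>
      Fin.succ_injective _ (Fin.succ_injective _ h)), Finset.card_univ, Fintype.card_fin]
  have hSspan : Submodule.span k (e '' ↑S) = W₁ ⊓ W₂ := by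
    rw [← hU]
    congr 1
    ext v
    simp only [hS_def, Finset.coe_image, Finset.coe_univ, Set.image_univ, Set.mem_image,
      Set.mem_range]
    constructor
    · rintro ⟨_, ⟨j, rfl⟩, rfl⟩
      exact ⟨j, (hess j).symm⟩
    · rintro ⟨j, rfl⟩
      exact ⟨_, ⟨j, rfl⟩, hess j⟩
  obtain ⟨y, hy, hy₁, hy₂⟩ := exists_common_zero_two_subframes_escaping hF he 1 0 S hvan₁ hvan₂
    (by rw [hScard]; exact hN)
  rw [hSspan] at hy
  -- the frame `(v₂, u)` of `W₂`
  have hind₂ : LinearIndependent k (Fin.cons v₂ u : Fin (d + 1) → Fin (N + 1) → k) :=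
    hu.finCons (by rwa [hU])
  have hspan₂ : Submodule.span k (Set.range (Fin.cons v₂ u : Fin (d + 1) → Fin (N + 1) → k)) =
      W₂ := by
    apply Submodule.eq_of_le_of_finrank_eq
    · rw [Fin.range_cons, Submodule.span_insert, hU]
      exact sup_le ((Submodule.span_singleton_le_iff_mem _ _).2 hv₂W) inf_le_right
    · rw [finrank_span_eq_card hind₂, Fintype.card_fin, h₂]
  -- translating back to `W₁`, `W₂`
  have hfun : ∀ (c : Fin (d + 2) → k) (t : k),
      (fun x => (∑ j, c j * e j x) + t * y x) = (∑ j, c j • e j) + t • y := by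
    intro c t
    funext x
    simp [Finset.sum_apply, Pi.smul_apply]
  refine ⟨y, hy, fun w hw t => ?_, fun w hw t => ?_⟩
  · rw [← hspan₁, Submodule.mem_span_range_iff_exists_fun] at hw
    obtain ⟨c', rfl⟩ := hw
    have h := hy₁ (Fin.cons 0 c') t rfl
    have hvec : (∑ j, (Fin.cons 0 c' : Fin (d + 2) → k) j • e j) =
        ∑ j, c' j • (Fin.cons v₁ u : Fin (d + 1) → Fin (N + 1) → k) j := by
      simp only [he_def, Fin.sum_univ_succ, Fin.cons_zero, Fin.cons_succ, zero_smul, zero_add]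
    rw [hfun, hvec] at h
    exact h
  · rw [← hspan₂, Submodule.mem_span_range_iff_exists_fun] at hw
    obtain ⟨c', rfl⟩ := hw
    have h := hy₂ (Fin.cons (c' 0) (Fin.cons 0 (Fin.tail c'))) t rfl
    have hvec : (∑ j, (Fin.cons (c' 0) (Fin.cons 0 (Fin.tail c')) : Fin (d + 2) → k) j • e j) =
        ∑ j, c' j • (Fin.cons v₂ u : Fin (d + 1) → Fin (N + 1) → k) j := by
      simp only [he_def, Fin.sum_univ_succ, Fin.cons_zero, Fin.cons_succ, Fin.tail, zero_smul,
        zero_add]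
    rw [hfun, hvec] at h
    exact h

end Isotropic

/-! ### Linear forms: kernel frames, and the forms of a frame vanish on it -/

section LinearForms

/-- Evaluation of the linear form with coefficient vector `c`: `(Σ_i c_i X_i)(v) = Σ_i c_i v_i`.
[folklore] -/
theorem eval_linForm (c v : Fin (N + 1) → k) : eval v (linForm c) = ∑ i, c i * v i := by
  rw [linForm_apply, map_sum]
  refine Finset.sum_congr rfl fun i _ => ?_
  rw [smul_eval, eval_X]

/-- A linear form is the evaluation of a `k`-linear functional on `kᴺ⁺¹`. [folklore] -/
theorem exists_linearMap_forall_eval_eq {L : MvPolynomial (Fin (N + 1)) k} (hL : L.IsHomogeneous 1) :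
    ∃ φ : (Fin (N + 1) → k) →ₗ[k] k, ∀ v, eval v L = φ v := by
  have h : L ∈ LinearMap.range (linForm (K := k) (n := N + 1)) := by
    rw [range_linForm]
    exact (mem_homogeneousSubmodule 1 L).2 hL
  obtain ⟨c, rfl⟩ := h
  refine ⟨{ toFun := fun v => ∑ x, c x * v x
            map_add' := fun v v' => by
              simp only [Pi.add_apply, mul_add, Finset.sum_add_distrib]
            map_smul' := fun a v => by
              simp only [Pi.smul_apply, smul_eq_mul, RingHom.id_apply, Finset.mul_sum]
              exact Finset.sum_congr rfl fun x _ => by ring }, fun v => ?_⟩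
  rw [eval_linForm]
  rfl

/-- **A linear form vanishing on a set vanishes on its span.** [folklore] -/
theorem forall_mem_span_eval_eq_zero_of_isHomogeneous_one {L : MvPolynomial (Fin (N + 1)) k}
    (hL : L.IsHomogeneous 1) {S : Set (Fin (N + 1) → k)} (h : ∀ v ∈ S, eval v L = 0) :
    ∀ v ∈ Submodule.span k S, eval v L = 0 := by
  obtain ⟨φ, hφ⟩ := exists_linearMap_forall_eval_eq hL
  have hle : Submodule.span k S ≤ LinearMap.ker φ := Submodule.span_le.2 fun v hv => by
    rw [SetLike.mem_coe, LinearMap.mem_ker, ← hφ]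
    exact h v hv
  intro v hv
  rw [hφ]
  exact hle hv

/-- **Kernel frame of independent linear forms.** For `t` linearly independent linear forms
`L₁, …, L_t` on `kᴺ⁺¹` there are `N + 1 - t` linearly independent vectors at which all the `L_i`
vanish (a frame of the common kernel, by rank–nullity for the `t × (N + 1)` coefficient matrix,
whose rows are independent). [folklore] -/
theorem exists_frame_of_linearIndependent_linearForms {t : ℕ}
    (L : Fin t → MvPolynomial (Fin (N + 1)) k) (hL : LinearIndependent k L)
    (hhom : ∀ j, (L j).IsHomogeneous 1) :
    ∃ w : Fin (N + 1 - t) → Fin (N + 1) → k, LinearIndependent k w ∧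
      ∀ i j, eval (w j) (L i) = 0 := by
  classical
  -- coefficient vectors of the `L_i`
  have hex : ∀ i, ∃ c : Fin (N + 1) → k, linForm c = L i := fun i => by
    have h : L i ∈ LinearMap.range (linForm (K := k) (n := N + 1)) := by
      rw [range_linForm]
      exact (mem_homogeneousSubmodule 1 (L i)).2 (hhom i)
    exact h
  choose c hc using hex
  have hcind : LinearIndependent k c := by
    refine LinearIndependent.of_comp (linForm (K := k) (n := N + 1)) ?_
    convert hL using 1
    funext i
    exact hc i
  -- the coefficient matrix and its kernel
  set M : Matrix (Fin t) (Fin (N + 1)) k := Matrix.of c with hM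
  have hrank : M.rank = t := by
    rw [LinearIndependent.rank_matrix (M := M) (by simpa [hM] using hcind), Fintype.card_fin]
  have hker : Module.finrank k ↥(LinearMap.ker M.mulVecLin) = N + 1 - t := by
    have h := LinearMap.finrank_range_add_finrank_ker M.mulVecLin
    rw [Module.finrank_fin_fun] at h
    change M.rank + _ = _ at h
    omega
  obtain ⟨w, hw, hspan⟩ := exists_frame_of_finrank_eq hker
  refine ⟨w, hw, fun i j => ?_⟩
  have hmem : w j ∈ LinearMap.ker M.mulVecLin := by
    rw [← hspan]
    exact Submodule.subset_span ⟨j, rfl⟩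
  rw [LinearMap.mem_ker, Matrix.mulVecLin_apply] at hmem
  have h := congr_fun hmem i
  rw [Matrix.mulVec, Pi.zero_apply] at h
  change (∑ x, M i x * w j x) = 0 at h
  rw [← hc i, eval_linForm]
  simpa [hM] using h

/-- **The linear forms of a frame vanish on it.** For `w₀, …, w_{u-1}` linearly independent in
`kᴺ⁺¹` (`k` infinite) there are `t = N + 1 - u` linearly independent linear forms `L₁, …, L_t`
vanishing on `span(w)` such that every polynomial vanishing on `span(w)` lies in `(L₁, …, L_t)` —
`Literature.RingTheory.MvPolynomial.exists_linearForms_forall_mem_ideal_span` with the vanishing of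
the `L_j` themselves recorded (they are the coordinate forms of a basis extending the `w_j`, along
the new vectors). [folklore] -/
theorem exists_linearForms_forall_mem_ideal_span_vanishing [Infinite k] {u : ℕ}
    {w : Fin u → Fin (N + 1) → k} (hw : LinearIndependent k w) :
    ∃ (t : ℕ) (L : Fin t → MvPolynomial (Fin (N + 1)) k), t + u = N + 1 ∧
      LinearIndependent k L ∧ (∀ j, (L j).IsHomogeneous 1) ∧
        (∀ j, ∀ v ∈ Submodule.span k (Set.range w), eval v (L j) = 0) ∧
        ∀ F : MvPolynomial (Fin (N + 1)) k, (∀ v ∈ Submodule.span k (Set.range w), eval v F = 0) →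
          F ∈ Ideal.span (Set.range L) := by
  classical
  -- extend `w` to a basis `b`, indexed by a set `E ⊇ range w` of vectors, `b i = i`
  have hli : LinearIndepOn k id (Set.range w) := hw.linearIndepOn_id
  have hsub : Set.range w ⊆ hli.extend (Set.subset_univ _) := hli.subset_extend _
  set b := Module.Basis.extend hli with hb_def
  have hb : ∀ i, b i = (i : Fin (N + 1) → k) := Module.Basis.extend_apply_self hli
  haveI : Fintype ↥(hli.extend (Set.subset_univ _)) := FiniteDimensional.fintypeBasisIndex b
  -- the new basis vectors
  set T : Set ↥(hli.extend (Set.subset_univ _)) :=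
    {i | (i : Fin (N + 1) → k) ∉ Set.range w} with hT
  -- every `F` vanishing on `span w` lies in the ideal of the coordinate forms along `T`
  have hmem : ∀ F : MvPolynomial (Fin (N + 1)) k,
      (∀ v ∈ Submodule.span k (Set.range w), eval v F = 0) →
        F ∈ Ideal.span ((fun i => ∑ m : Fin (N + 1), C (b.repr (Pi.single m 1) i) * X m) '' T) := by
    intro F hv
    refine mem_ideal_span_coordForm_of_forall_eval_eq_zero b T F fun c hc => ?_
    have hfun : (fun m => ∑ i, c i * b i m) = ∑ i, c i • (b i : Fin (N + 1) → k) := by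
      funext m
      simp [Finset.sum_apply, Pi.smul_apply]
    rw [hfun]
    refine hv _ (Submodule.sum_mem _ fun i _ => ?_)
    by_cases hi : i ∈ T
    · rw [hc i hi, zero_smul]
      exact Submodule.zero_mem _
    · refine Submodule.smul_mem _ _ (Submodule.subset_span ?_)
      rw [hb]
      simpa [hT] using hi
  -- the coordinate forms along `T` vanish on `span w ⊆ span (b '' Tᶜ)`
  have hwspan : Submodule.span k (Set.range w) ≤ Submodule.span k (b '' Tᶜ) := by
    refine Submodule.span_mono ?_
    rintro _ ⟨j, rfl⟩
    refine ⟨⟨w j, hsub ⟨j, rfl⟩⟩, ?_, hb _⟩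
    simp [hT]
  have hvanT : ∀ i ∈ T, ∀ v ∈ Submodule.span k (Set.range w),
      eval v (∑ m : Fin (N + 1), C (b.repr (Pi.single m 1) i) * X m) = 0 := by
    intro i hi v hv
    rw [eval_coordForm]
    have hsupp := b.repr_support_subset_of_mem_span (Tᶜ) (hwspan hv)
    by_contra hne
    exact hsupp (Finsupp.mem_support_iff.2 hne) hi
  -- counting: `#E = N + 1`, `#Tᶜ = u`
  have hcardE : Fintype.card ↥(hli.extend (Set.subset_univ _)) = N + 1 := by
    have h := Module.finrank_eq_card_basis b
    rwa [Module.finrank_fin_fun, eq_comm] at h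
  have eT : ↥Tᶜ ≃ Fin u :=
    { toFun := fun i => (Equiv.ofInjective w hw.injective).symm
        ⟨(i.1 : Fin (N + 1) → k), by simpa [hT] using i.2⟩
      invFun := fun j => ⟨⟨w j, hsub ⟨j, rfl⟩⟩, by simp [hT]⟩
      left_inv := fun i => by
        apply Subtype.ext
        apply Subtype.ext
        exact Equiv.apply_ofInjective_symm hw.injective _
      right_inv := fun j => by
        simp only
        exact Equiv.ofInjective_symm_apply hw.injective j }
  have hcardTc : Fintype.card ↥Tᶜ = u := (Fintype.card_congr eT).trans (Fintype.card_fin u)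
  have hcompl := Fintype.card_compl_set T
  have hle : Fintype.card ↥T ≤ Fintype.card ↥(hli.extend (Set.subset_univ _)) :=
    set_fintype_card_le_univ T
  -- reindex `T` by `Fin t`
  let e : Fin (Fintype.card ↥T) ≃ ↥T := (Fintype.equivFin ↥T).symm
  have hrange : Set.range (fun j => ∑ m : Fin (N + 1),
      C (b.repr (Pi.single m 1) (e j : ↥(hli.extend (Set.subset_univ _)))) * X m) =
      (fun i => ∑ m : Fin (N + 1), C (b.repr (Pi.single m 1) i) * X m) '' T := by
    ext p
    simp only [Set.mem_range, Set.mem_image]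
    constructor
    · rintro ⟨j, rfl⟩
      exact ⟨e j, (e j).2, rfl⟩
    · rintro ⟨i, hi, rfl⟩
      exact ⟨e.symm ⟨i, hi⟩, by simp⟩
  refine ⟨Fintype.card ↥T,
    fun j => ∑ m : Fin (N + 1), C (b.repr (Pi.single m 1) (e j : ↥(hli.extend _))) * X m,
    by omega, ?_, fun j => isHomogeneous_coordForm b _, fun j v hv => hvanT _ (e j).2 v hv,
    fun F hv => ?_⟩
  · exact ((linearIndependent_coordForm b).comp _ Subtype.val_injective).comp _ e.injective
  · rw [hrange]
    exact hmem F hv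

end LinearForms

end Literature.RingTheory.MvPolynomial

end
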